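import Summits.CriticalPhenomena.PercolationContinuityZ3.Theorems.PercNearOneGluingNoHeavyLowerTailLightnessDiamond
import HarnessLib

/-!
# `NoHeavyLowerTail` (stmt-CriticalPhenomena-4575) — the GENERALIZED LIGHTNESS DIAMOND and the STAR Hall cuts of CIL

Support file (prover `prim-lf-4`, lemma factory "LP-duality"; `--supports stmt-CriticalPhenomena-4575`).  No definitions,
no named facts, no sorries.

Bond percolation `μ = prodBernoulli w` on a finite vertex type, relays `A : Finset V`, level `j`; for a vertex `v`,
`π(v) = A.filter (v ↔ ·)` and `R_v = {|π(v)| ≤ j}` ("`v` light"), `R_vᶜ` ("`v` heavy").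

Transport/LP-duality picture of the cumulative isolation lemma `CIL_j` (memo DIAMOND-STAR.md, crux evidence): with
`c` a champion (`μ(R_x) ≤ μ(R_c)` for all `x`), `CIL_j(c)` reads `μ(1 ≤ N ≤ j, c heavy) ≤ μ(N = 0, c light) + μ(N > j, c light)`
(`N = |π(o)|`), and the sharp form `CIL♯` holds together with a coupling that only GROWS the observer's pocket iff every
Hall cut `Σ_{S ∈ 𝔉} μ(π(o) = S, c heavy) ≤ μ(N > j, c light, π(o) ⊇ some S ∈ 𝔉)` holds.  This file proves ALL cuts whose
family `𝔉` has a common element `x` ("star cuts"), for every `|A|` and `j`, from ONE application of the two-cluster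
exchange inequality of van den Berg–Häggström–Kahn:

* `generalizedLightnessDiamond` — for `x ≠ y` and EVERY event `E` of type `(+)` for the pair `(x, y)` (closed under
  enlarging `C_x` and shrinking `C_y`):  `μ(E ∩ R_x ∩ R_yᶜ) · μ(R_xᶜ ∩ R_y) ≤ μ(E ∩ R_xᶜ ∩ R_y) · μ(R_x ∩ R_yᶜ)`.
  (`Theorems.lightnessDiamond` is the case `E = {o ↔ x}`; the proof is the same.)
* `typePlus_le_of_lighter` — if moreover `μ(R_x) ≤ μ(R_y)` (e.g. `y` a champion) then
  `μ(E ∩ R_x ∩ R_yᶜ) ≤ μ(E ∩ R_xᶜ ∩ R_y)`:  whatever is good for `C_x` and happens while `x` is light and `y` heavy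
  happens at least as often with the two roles exchanged.
* `pocketDomination` — the single-set Hall cut (PS1/PD1/PSm of the memo), all `|A|`, `j`, all `S` with `x ∈ S`:
  `μ(π(o) = S ∧ c heavy) ≤ μ(S ⊆ π(o) ∧ |π(o)| > j ∧ c light)`.  At the rung `(|A|, j) = (5, 2)` with `S = {x, y}` this is
  the PAIR-POCKET inequality `μ(o x y | c z w) ≤ μ({x,y} ⊆ π(o) = giant ∌ c)`.
* `reach_light_heavy_le` — the full `x`-star cut: `μ({o ↔ x} ∩ R_x ∩ R_cᶜ) ≤ μ({o ↔ x} ∩ R_xᶜ ∩ R_c)`; summed over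
  `x ∈ A ∖ {c}` it is the moment inequality `E[N; 1 ≤ N ≤ j, c heavy] ≤ E[N; N > j, c light]` of the memo.
-/

noncomputable section

namespace Summit.CriticalPhenomena.PercolationContinuityZ3.Theorems

open MeasureTheory Set
open Literature.Probability.LatticeModels (prodBernoulli)
open Literature.Probability.Percolation
open Literature.Probability.Percolation.TwoClusterExchange
open Literature.Probability.Percolation.LonelyClusterExchange
open LightnessDiamond
open scoped Classical

variable {V : Type*}

/-- **Generalized lightness diamond.**  For `x ≠ y`, any `A`, `j`, and any event `E` of type `(+)` for the pair
`(x, y)` (closed under enlarging the open edge cluster of `x` and shrinking that of `y`), with `R_v = {|π(v)| ≤ j}`: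
`μ(E ∩ R_x ∩ R_yᶜ) · μ(R_xᶜ ∩ R_y) ≤ μ(E ∩ R_xᶜ ∩ R_y) · μ(R_x ∩ R_yᶜ)`.
One application of `twoClusterExchange` (BHK 2006 Thm 1.5, event form) with `s = x`, `t = y`, `A₁ = E`,
`B₁ = R_x ∩ R_yᶜ`, `A₂ = R_xᶜ ∩ R_y`, `B₂ = ⊤`; the conditioning `{x ↮ y}` is implied by both mixed cells.
[cite: VandenbergHaggstromKahn2005, Thm. 1.5 (p. 7) — corollary, derived in this file] -/
theorem generalizedLightnessDiamond [Fintype V] (w : Sym2 V → unitInterval) (A : Finset V) (x y : V) (j : ℕ)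
    (hxy : x ≠ y) (E : Set (BondConfig V))
    (hE : ∀ ⦃ω ω' : BondConfig V⦄, openEdgeCluster ω x ⊆ openEdgeCluster ω' x →
      openEdgeCluster ω' y ⊆ openEdgeCluster ω y → ω ∈ E → ω' ∈ E) :
    (prodBernoulli w).real (E ∩ {ω : BondConfig V | (A.filter fun z => ω ∈ openConn x z).card ≤ j} ∩
        {ω : BondConfig V | (A.filter fun z => ω ∈ openConn y z).card ≤ j}ᶜ) *
      (prodBernoulli w).real ({ω : BondConfig V | (A.filter fun z => ω ∈ openConn x z).card ≤ j}ᶜ ∩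
        {ω : BondConfig V | (A.filter fun z => ω ∈ openConn y z).card ≤ j}) ≤
    (prodBernoulli w).real (E ∩ {ω : BondConfig V | (A.filter fun z => ω ∈ openConn x z).card ≤ j}ᶜ ∩
        {ω : BondConfig V | (A.filter fun z => ω ∈ openConn y z).card ≤ j}) *
      (prodBernoulli w).real ({ω : BondConfig V | (A.filter fun z => ω ∈ openConn x z).card ≤ j} ∩
        {ω : BondConfig V | (A.filter fun z => ω ∈ openConn y z).card ≤ j}ᶜ) := by
  set Rx : Set (BondConfig V) := {ω | (A.filter fun z => ω ∈ openConn x z).card ≤ j} with hRx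
  set Ry : Set (BondConfig V) := {ω | (A.filter fun z => ω ∈ openConn y z).card ≤ j} with hRy
  set D : Set (BondConfig V) := (openConn x y)ᶜ with hD
  have key := twoClusterExchange w hxy
    (A₁ := E) (A₂ := Rxᶜ ∩ Ry) (B₁ := Rx ∩ Ryᶜ) (B₂ := (univ : Set (BondConfig V)))
    (fun ω ω' h1 h2 hω => hE h1 h2 hω)
    (fun ω ω' h1 h2 hω => ⟨typePlus_card_gt A j x y h1 h2 hω.1, typePlus_card_le A j x y h1 h2 hω.2⟩)
    (fun ω ω' h1 h2 hω => ⟨typeMinus_card_le A j x y h1 h2 hω.1, typeMinus_card_gt A j x y h1 h2 hω.2⟩)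
    (fun _ _ _ _ _ => mem_univ _)
  -- remove the conditioning `D`: both mixed cells lie inside `{x ↮ y}`
  have hF : D ∩ (Rx ∩ Ryᶜ) = Rx ∩ Ryᶜ :=
    inter_eq_right.mpr (light_inter_heavy_subset A j x y)
  have hG : D ∩ (Rxᶜ ∩ Ry) = Rxᶜ ∩ Ry := by
    refine inter_eq_right.mpr ?_
    intro ω hω
    have h' := light_inter_heavy_subset A j y x ⟨hω.2, hω.1⟩
    intro hc
    exact h' (SimpleGraph.Reachable.symm hc : (openGraph ω).Reachable y x)
  have h1 : D ∩ (E ∩ (Rx ∩ Ryᶜ)) = E ∩ Rx ∩ Ryᶜ := by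
    rw [← inter_assoc, inter_comm D, inter_assoc, hF, ← inter_assoc]
  have h2 : D ∩ (Rxᶜ ∩ Ry ∩ univ) = Rxᶜ ∩ Ry := by rw [inter_univ, hG]
  have h3 : D ∩ (E ∩ (Rxᶜ ∩ Ry)) = E ∩ Rxᶜ ∩ Ry := by
    rw [← inter_assoc, inter_comm D, inter_assoc, hG, ← inter_assoc]
  have h4 : D ∩ (Rx ∩ Ryᶜ ∩ univ) = Rx ∩ Ryᶜ := by rw [inter_univ, hF]
  rw [h1, h2, h3, h4] at key
  exact key

/-- **Exchange of roles under the champion hypothesis.**  For `x ≠ y` with `μ(R_x) ≤ μ(R_y)` (`y` is at least as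
often light as `x`, e.g. `y` a champion) and any event `E` of type `(+)` for `(x, y)`:
`μ(E ∩ R_x ∩ R_yᶜ) ≤ μ(E ∩ R_xᶜ ∩ R_y)`.  From `generalizedLightnessDiamond`: the hypothesis gives
`μ(R_x ∩ R_yᶜ) ≤ μ(R_xᶜ ∩ R_y)` (subtract `μ(R_x ∩ R_y)`), and the diamond transfers the ratio. [this file] -/
theorem typePlus_le_of_lighter [Fintype V] (w : Sym2 V → unitInterval) (A : Finset V) (x y : V) (j : ℕ)
    (hxy : x ≠ y) (E : Set (BondConfig V))
    (hE : ∀ ⦃ω ω' : BondConfig V⦄, openEdgeCluster ω x ⊆ openEdgeCluster ω' x →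
      openEdgeCluster ω' y ⊆ openEdgeCluster ω y → ω ∈ E → ω' ∈ E)
    (hK : (prodBernoulli w).real {ω : BondConfig V | (A.filter fun z => ω ∈ openConn x z).card ≤ j} ≤
      (prodBernoulli w).real {ω : BondConfig V | (A.filter fun z => ω ∈ openConn y z).card ≤ j}) :
    (prodBernoulli w).real (E ∩ {ω : BondConfig V | (A.filter fun z => ω ∈ openConn x z).card ≤ j} ∩
        {ω : BondConfig V | (A.filter fun z => ω ∈ openConn y z).card ≤ j}ᶜ) ≤
      (prodBernoulli w).real (E ∩ {ω : BondConfig V | (A.filter fun z => ω ∈ openConn x z).card ≤ j}ᶜ ∩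
        {ω : BondConfig V | (A.filter fun z => ω ∈ openConn y z).card ≤ j}) := by
  set μ := prodBernoulli w with hμ
  set Rx : Set (BondConfig V) := {ω | (A.filter fun z => ω ∈ openConn x z).card ≤ j} with hRx
  set Ry : Set (BondConfig V) := {ω | (A.filter fun z => ω ∈ openConn y z).card ≤ j} with hRy
  have hmeas : ∀ S : Set (BondConfig V), MeasurableSet S := fun S => (Set.toFinite S).measurableSet
  have dia := generalizedLightnessDiamond w A x y j hxy E hE
  -- the champion hypothesis on the two mixed cells
  have sx : μ.real (Rx ∩ Ry) + μ.real (Rx \ Ry) = μ.real Rx := measureReal_inter_add_sdiff (hmeas Ry)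
  have sy : μ.real (Ry ∩ Rx) + μ.real (Ry \ Rx) = μ.real Ry := measureReal_inter_add_sdiff (hmeas Rx)
  have eC : μ.real (Ry ∩ Rx) = μ.real (Rx ∩ Ry) := by rw [inter_comm]
  have eF : μ.real (Rx \ Ry) = μ.real (Rx ∩ Ryᶜ) := rfl
  have eG : μ.real (Ry \ Rx) = μ.real (Rxᶜ ∩ Ry) := by rw [show Ry \ Rx = Ry ∩ Rxᶜ from rfl, inter_comm]
  have hFG : μ.real (Rx ∩ Ryᶜ) ≤ μ.real (Rxᶜ ∩ Ry) := by linarith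
  have hL0 : 0 ≤ μ.real (E ∩ Rx ∩ Ryᶜ) := measureReal_nonneg
  have hR0 : 0 ≤ μ.real (E ∩ Rxᶜ ∩ Ry) := measureReal_nonneg
  have hF0 : 0 ≤ μ.real (Rx ∩ Ryᶜ) := measureReal_nonneg
  -- `μ(E ∩ Rx ∩ Ryᶜ) ≤ μ(Rx ∩ Ryᶜ)`
  have hLF : μ.real (E ∩ Rx ∩ Ryᶜ) ≤ μ.real (Rx ∩ Ryᶜ) := by
    refine measureReal_mono ?_ (measure_ne_top _ _)
    intro ω hω; exact ⟨hω.1.2, hω.2⟩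
  rcases hF0.eq_or_lt with hF | hF
  · -- degenerate: the bad mixed cell is null
    linarith
  · -- `L · G ≤ R · F`, `F ≤ G`, `F > 0` ⇒ `L ≤ R`
    have h2 : μ.real (E ∩ Rx ∩ Ryᶜ) * μ.real (Rx ∩ Ryᶜ) ≤
        μ.real (E ∩ Rx ∩ Ryᶜ) * μ.real (Rxᶜ ∩ Ry) := mul_le_mul_of_nonneg_left hFG hL0
    exact le_of_mul_le_mul_right (h2.trans dia) hF

namespace DiamondStar

/-- The event "`o` and every vertex of `S` lie in the cluster of `x`" is of type `(+)` for any pair `(x, y)`. [folklore] -/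
theorem typePlus_reachSet (S : Finset V) (x y o : V) ⦃ω ω' : BondConfig V⦄
    (hs : openEdgeCluster ω x ⊆ openEdgeCluster ω' x) (ht : openEdgeCluster ω' y ⊆ openEdgeCluster ω y)
    (h : ω ∈ ((openConn x o : Set (BondConfig V)) ∩ {ω : BondConfig V | ∀ z ∈ S, ω ∈ (openConn x z : Set (BondConfig V))})) :
    ω' ∈ ((openConn x o : Set (BondConfig V)) ∩ {ω : BondConfig V | ∀ z ∈ S, ω ∈ (openConn x z : Set (BondConfig V))}) :=
  ⟨typePlus_openConn x y o hs ht h.1, fun z hz => typePlus_openConn x y z hs ht (h.2 z hz)⟩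

end DiamondStar

open DiamondStar

/-- **Pocket domination (the single-set Hall cut; PS1/PD1/PSm of the memo).**  Let `x ≠ c` with `μ(R_x) ≤ μ(R_c)`
(e.g. `c` a champion) and let `S ⊆ A` contain `x`, `|S| ≤ j`.  Then
`μ(π(o) = S ∧ c heavy) ≤ μ(S ⊆ π(o) ∧ |π(o)| > j ∧ c light)`  (with `π(v) = A.filter (v ↔ ·)`), for every `|A|`, `j`
(nontrivial when `S ⊆ A` and `|S| ≤ j`).  At `(|A|, j) = (5, 2)`, `S = {x, y}`: the pair pocket `μ(o x y | c z w)` is at most the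
mass of `{x, y} ⊆ π(o) = giant`, `c ∉ giant`.  Proof: `typePlus_le_of_lighter` with `E = {o ∈ C_x} ∩ {S ⊆ C_x}`; on
`{π(o) = S}` we have `o ↔ x`, hence `π(x) = π(o) = S` is light, and on `E ∩ R_xᶜ ∩ R_c` we have `π(o) = π(x) ⊇ S` heavy. [this file] -/
theorem pocketDomination [Fintype V] (w : Sym2 V → unitInterval) (A S : Finset V) (o x c : V) (j : ℕ)
    (hxc : x ≠ c) (hxS : x ∈ S) (hSA : S ⊆ A) (hSj : S.card ≤ j)
    (hK : (prodBernoulli w).real {ω : BondConfig V | (A.filter fun z => ω ∈ openConn x z).card ≤ j} ≤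
      (prodBernoulli w).real {ω : BondConfig V | (A.filter fun z => ω ∈ openConn c z).card ≤ j}) :
    (prodBernoulli w).real {ω : BondConfig V | (A.filter fun z => ω ∈ openConn o z) = S ∧
        ¬ (A.filter fun z => ω ∈ openConn c z).card ≤ j} ≤
      (prodBernoulli w).real {ω : BondConfig V | S ⊆ (A.filter fun z => ω ∈ openConn o z) ∧
        j < (A.filter fun z => ω ∈ openConn o z).card ∧ (A.filter fun z => ω ∈ openConn c z).card ≤ j} := by
  set μ := prodBernoulli w with hμ
  set Rx : Set (BondConfig V) := {ω | (A.filter fun z => ω ∈ openConn x z).card ≤ j} with hRx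
  set Rc : Set (BondConfig V) := {ω | (A.filter fun z => ω ∈ openConn c z).card ≤ j} with hRc
  set E : Set (BondConfig V) := (openConn x o : Set (BondConfig V)) ∩
    {ω : BondConfig V | ∀ z ∈ S, ω ∈ (openConn x z : Set (BondConfig V))} with hEdef
  have main := typePlus_le_of_lighter w A x c j hxc E (fun ω ω' h1 h2 hω => typePlus_reachSet S x c o h1 h2 hω) hK
  refine le_trans (measureReal_mono ?_ (measure_ne_top _ _)) (le_trans main (measureReal_mono ?_ (measure_ne_top _ _)))
  · -- `{π(o) = S, c heavy} ⊆ E ∩ R_x ∩ R_cᶜ`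
    rintro ω ⟨hS, hc⟩
    have hox : ω ∈ (openConn o x : Set (BondConfig V)) := by
      have : x ∈ A.filter fun z => ω ∈ openConn o z := hS ▸ hxS
      exact (Finset.mem_filter.1 this).2
    have hxo : ω ∈ (openConn x o : Set (BondConfig V)) := by
      rw [Literature.Probability.Percolation.KNPreFKG.openConn_symm]; exact hox
    have hpx : (A.filter fun z => ω ∈ openConn x z) = (A.filter fun z => ω ∈ openConn o z) :=
      (filter_eq_of_openConn A o x hox).symm
    refine ⟨⟨⟨hxo, fun z hz => ?_⟩, ?_⟩, hc⟩
    · have : z ∈ A.filter fun z => ω ∈ openConn x z := by rw [hpx, hS]; exact hz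
      exact (Finset.mem_filter.1 this).2
    · show (A.filter fun z => ω ∈ openConn x z).card ≤ j
      rw [hpx, hS]; exact hSj
  · -- `E ∩ R_xᶜ ∩ R_c ⊆ {S ⊆ π(o), |π(o)| > j, c light}`
    rintro ω ⟨⟨⟨hxo, hS⟩, hx⟩, hc⟩
    have hox : ω ∈ (openConn o x : Set (BondConfig V)) := by
      rw [Literature.Probability.Percolation.KNPreFKG.openConn_symm]; exact hxo
    have hpx : (A.filter fun z => ω ∈ openConn x z) = (A.filter fun z => ω ∈ openConn o z) :=
      (filter_eq_of_openConn A o x hox).symm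
    refine ⟨fun z hz => ?_, ?_, hc⟩
    · rw [← hpx]
      exact Finset.mem_filter.2 ⟨hSA hz, hS z hz⟩
    · show j < (A.filter fun z => ω ∈ openConn o z).card
      rw [← hpx]; exact not_le.1 hx

/-- **The full `x`-star cut** (all pockets through `x` at once): for `x ≠ c` with `μ(R_x) ≤ μ(R_c)`,
`μ({o ↔ x} ∩ R_x ∩ R_cᶜ) ≤ μ({o ↔ x} ∩ R_xᶜ ∩ R_c)`, i.e. `μ(x ∈ π(o), |π(o)| ≤ j, c heavy) ≤ μ(x ∈ π(o), |π(o)| > j, c light)`.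
`Theorems.lightnessDiamond` plus the champion row; equivalently `typePlus_le_of_lighter` with `E = {x ↔ o}`. [this file] -/
theorem reach_light_heavy_le [Fintype V] (w : Sym2 V → unitInterval) (A : Finset V) (o x c : V) (j : ℕ) (hxc : x ≠ c)
    (hK : (prodBernoulli w).real {ω : BondConfig V | (A.filter fun z => ω ∈ openConn x z).card ≤ j} ≤
      (prodBernoulli w).real {ω : BondConfig V | (A.filter fun z => ω ∈ openConn c z).card ≤ j}) :
    (prodBernoulli w).real ((openConn o x : Set (BondConfig V)) ∩
        {ω : BondConfig V | (A.filter fun z => ω ∈ openConn x z).card ≤ j} ∩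
        {ω : BondConfig V | (A.filter fun z => ω ∈ openConn c z).card ≤ j}ᶜ) ≤
      (prodBernoulli w).real ((openConn o x : Set (BondConfig V)) ∩
        {ω : BondConfig V | (A.filter fun z => ω ∈ openConn x z).card ≤ j}ᶜ ∩
        {ω : BondConfig V | (A.filter fun z => ω ∈ openConn c z).card ≤ j}) := by
  rw [Literature.Probability.Percolation.KNPreFKG.openConn_symm o x]
  exact typePlus_le_of_lighter w A x c j hxc (openConn x o) (fun ω ω' h1 h2 hω => typePlus_openConn x c o h1 h2 hω) hK

/-- **Moment form of the star cuts (M1 of the memo, summed over the non-champion relays).**  If `c ∈ A` is a champion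
(`μ(R_x) ≤ μ(R_c)` for every `x ∈ A`), then
`Σ_{x ∈ A ∖ c} μ({o ↔ x} ∩ R_x ∩ R_cᶜ) ≤ Σ_{x ∈ A ∖ c} μ({o ↔ x} ∩ R_xᶜ ∩ R_c)`;
since `o ↔ x` forces `π(x) = π(o)`, the two sides are `E[N; 1 ≤ N ≤ j, c heavy]` and `E[N; N > j, c light]` (`N = |π(o)|`):
fat pockets are paid for `k`-uniformly (`μ(αk < N ≤ j, c heavy) ≤ α⁻¹ μ(N > j, c light)`). [this file] -/
theorem sum_reach_light_heavy_le [Fintype V] (w : Sym2 V → unitInterval) (A : Finset V) (o c : V) (j : ℕ)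
    (hK : ∀ x ∈ A, (prodBernoulli w).real {ω : BondConfig V | (A.filter fun z => ω ∈ openConn x z).card ≤ j} ≤
      (prodBernoulli w).real {ω : BondConfig V | (A.filter fun z => ω ∈ openConn c z).card ≤ j}) :
    ∑ x ∈ A.erase c, (prodBernoulli w).real ((openConn o x : Set (BondConfig V)) ∩
        {ω : BondConfig V | (A.filter fun z => ω ∈ openConn x z).card ≤ j} ∩
        {ω : BondConfig V | (A.filter fun z => ω ∈ openConn c z).card ≤ j}ᶜ) ≤
      ∑ x ∈ A.erase c, (prodBernoulli w).real ((openConn o x : Set (BondConfig V)) ∩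
        {ω : BondConfig V | (A.filter fun z => ω ∈ openConn x z).card ≤ j}ᶜ ∩
        {ω : BondConfig V | (A.filter fun z => ω ∈ openConn c z).card ≤ j}) := by
  refine Finset.sum_le_sum fun x hx => ?_
  exact reach_light_heavy_le w A o x c j (Finset.ne_of_mem_erase hx) (hK x (Finset.mem_of_mem_erase hx))

end Summit.CriticalPhenomena.PercolationContinuityZ3.Theorems

end
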